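import Literature.NumberTheory.Sieve.BombieriFriedlanderIwaniecTheorem9
import Literature.NumberTheory.Sieve.BombieriFriedlanderIwaniecCombinatorics
import HarnessLib

/-!
# Bombieri–Friedlander–Iwaniec 1986, Theorem 9: proved reductions

Topic `Literature/NumberTheory/Sieve`, sibling of
`Literature.NumberTheory.Sieve.BombieriFriedlanderIwaniecTheorem9`, which vendors Theorem 9 of
E. Bombieri, J. B. Friedlander, H. Iwaniec, *Primes in arithmetic progressions to large moduli*,
Acta Math. 156 (1986), 203–251 (§1, p. 209) as the named fact
`Literature.NumberTheory.Sieve.BombieriFriedlanderIwaniecTheorem9`, together with the two bilinear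
theorems its proof (§16, p. 250) appeals to (`…Theorem6`, `…Theorem7Star`).  Everything here is
PROVED; no named fact is introduced.

## Status of the discharge `BombieriFriedlanderIwaniecTheorem9_holds`

The source proves Theorem 9 in §16 ("The proof is much the same as that of Theorem 8; the
difference is that we appeal to Theorems 6 and 7* instead of 1, 2, 3, 4 and 5*"): Heath-Brown's
identity (Lemma 5) and the box partition of §15, the bilinear pieces with a partial product in the
range (16.1) going to **Theorem 6** (§13: Linnik's dispersion method and the Deshouillers–Iwaniec
bounds for sums of Kloosterman sums, Lemma 1), the remaining pieces (`ν₁ ≥ … ≥ ν_k ≥ (1−θ₂)/3 − ε`,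
`τ ≤ θ₂ + ε`, `1 ≤ k ≤ 3`) to **Theorem 7*** (§14, Lemmas 1, 2, 4).  Both inputs are unproved
named facts of the tree (neither the dispersion method for the weights (A₇) nor the
Deshouillers–Iwaniec bounds are in Mathlib or in the tree), so the discharge is conditional on them
exactly as `BombieriFriedlanderIwaniecTheorem10` is conditional on Theorems 1, 2, 5
(`Literature.NumberTheory.Sieve.BombieriFriedlanderIwaniecTheorem10_of_theorem1_theorem2_theorem5`).

## Contents

* `BombieriFriedlanderIwaniecTheorem9.of_signed`, `BombieriFriedlanderIwaniecTheorem9.signed` — the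
  first step of §16: Theorem 9 (absolute values over `r`) is EQUIVALENT to its signed form, the
  shape of Theorem 8 (p. 209) with the weights `γ_q = 1` (`q ≤ Q`) and any real `|δ_r| ≤ 1`, which
  is the shape in which the dispersion sum `𝒟` of Theorem 6 (weights (A₇): `γ = 1`, `δ` arbitrary)
  enters.
* `BFI.section16_dichotomy` — the combinatorial case split of §16 (p. 250) for the exponents
  `μ_i, ν_i ≥ 0` of a Heath-Brown piece `M₁ ⋯ M_j N₁ ⋯ N_j = x` ((15.6), summing to `1`), with
  `θ = θ₂` (`R = x^{θ₂}`) and a slack `e`: either some partial sum `λ` lies in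
  `[θ + 2e, (1−θ)/3 − 2e]` (so that (16.1) `θ₂ + e < λ < (1−θ₂)/3 − e` holds strictly and
  **Theorem 6** applies), or the terms `≥ θ + 2e` are all `> (1−θ)/3 − 2e`, they number `k` with
  `1 ≤ k ≤ 3`, and the remaining terms total `τ < θ + 2e` ((16.2); **Theorem 7*** applies).  PROVED
  from the general partial-sum dichotomy `BFI.exists_subsum_mem_Icc_or` of the §17 file.
* `BFI.range_theorem6_of_mem`, `BFI.range_theorem7Star_of_two_le`, `BFI.range_theorem7Star_of_one`
  — the exponent arithmetic of §16: in the first case the range `x^e R' < N < x^{−e} (x/R')^{1/3}`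
  of Theorem 6 for every block `R' = x^{θ'}`, `θ' ≤ θ`; in the second case the hypotheses (14.5)
  `LR < x^{1/2−e}` and (14.6) `L^{1/2} R < M x^{−e}` of Theorem 7* with `M = x^{ν₁}`,
  `N = x^{ν₂}` (resp. `N = 1` when `k = 1`), `L = x/MN`, given `θ < 1/10 − ε` and `5e ≤ ε`
  (p. 250: "since `θ₂ < 1/10`, the previous inequalities hold for sufficiently small `ε`").  Pure
  linear arithmetic; the analytic bookkeeping belongs to the assembly.

## References

* E. Bombieri, J. B. Friedlander, H. Iwaniec, *Primes in arithmetic progressions to large moduli*,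
  Acta Math. 156 (1986), 203–251: §1 Theorems 8, 9 (p. 209); §16 (p. 250).
  [BombieriFriedlanderIwaniecActa1986]
-/

open Finset Real

namespace Literature.NumberTheory.Sieve

/-! ### The signed (bilinear-weights) form of Theorem 9 -/

/-- **Theorem 9 from its signed form**: if for every real weight `δ` with `|δ_r| ≤ 1` the signed
double sum `∑_{r ≤ R, (r,a)=1} δ_r ∑_{q ≤ Q, (q,a)=1} (ψ(x; qr, a) − x/φ(qr))` is `≤ C x ℒ^{−A}` in
absolute value (same quantifiers as Theorem 9, `δ` quantified innermost), then Theorem 9 holds —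
take `δ_r = sgn ∑_q (…)` (BFI §16, p. 250, first sentence: the reduction to the shape of Theorem 8,
p. 209, with `γ ≡ 1`). [cite: BombieriFriedlanderIwaniecActa1986, §16 p. 250; §1 Theorems 8, 9 p. 209] -/
theorem BombieriFriedlanderIwaniecTheorem9.of_signed
    (h : ∀ a : ℤ, a ≠ 0 → ∀ ε : ℝ, 0 < ε → ∀ A : ℝ, 0 < A →
      ∃ B C x₀ : ℝ, ∀ x : ℝ, x₀ ≤ x → ∀ Q R : ℝ,
        R < x ^ (1 / 10 - ε) → Q * R < x / Real.log x ^ B → ∀ δ : ℕ → ℝ, (∀ r, |δ r| ≤ 1) →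
          |∑ r ∈ (Icc 1 ⌊R⌋₊).filter (fun r : ℕ => IsCoprime (r : ℤ) a),
              δ r * ∑ q ∈ (Icc 1 ⌊Q⌋₊).filter (fun q : ℕ => IsCoprime (q : ℤ) a),
                (LevelOfDistribution.chebyshevPsiMod (q * r) (a : ZMod (q * r)) x -
                  x / (Nat.totient (q * r) : ℝ))| ≤
            C * x / Real.log x ^ A) :
    BombieriFriedlanderIwaniecTheorem9 := by
  intro a ha ε hε A hA
  obtain ⟨B, C, x₀, hB⟩ := h a ha ε hε A hA
  refine ⟨B, C, x₀, fun x hx Q R hR hQR => ?_⟩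
  -- the inner sums and their signs
  set S : ℕ → ℝ := fun r => ∑ q ∈ (Icc 1 ⌊Q⌋₊).filter (fun q : ℕ => IsCoprime (q : ℤ) a),
    (LevelOfDistribution.chebyshevPsiMod (q * r) (a : ZMod (q * r)) x -
      x / (Nat.totient (q * r) : ℝ)) with hS
  set δ : ℕ → ℝ := fun r => if 0 ≤ S r then 1 else -1 with hδ
  have hδ1 : ∀ r, |δ r| ≤ 1 := fun r => by
    simp only [hδ]; split_ifs <;> simp
  have hδS : ∀ r, δ r * S r = |S r| := fun r => by
    simp only [hδ]
    split_ifs with h0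
    · rw [one_mul, abs_of_nonneg h0]
    · rw [abs_of_neg (not_le.mp h0)]; ring
  have key := hB x hx Q R hR hQR δ hδ1
  have hsum : ∑ r ∈ (Icc 1 ⌊R⌋₊).filter (fun r : ℕ => IsCoprime (r : ℤ) a), δ r * S r =
      ∑ r ∈ (Icc 1 ⌊R⌋₊).filter (fun r : ℕ => IsCoprime (r : ℤ) a), |S r| :=
    Finset.sum_congr rfl fun r _ => hδS r
  rw [hsum, abs_of_nonneg (Finset.sum_nonneg fun r _ => abs_nonneg _)] at key
  exact key

/-- **The signed form of Theorem 9** (the shape of Theorem 8, p. 209, with `γ_q = 1` and any real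
`|δ_r| ≤ 1`): from Theorem 9, for `a ≠ 0`, `ε > 0`, `A > 0` there are `B, C, x₀` such that for
`x ≥ x₀`, `R < x^{1/10−ε}`, `QR < x ℒ^{−B}` and every `δ` with `|δ_r| ≤ 1`,
`|∑_{r ≤ R, (r,a)=1} δ_r ∑_{q ≤ Q, (q,a)=1} (ψ(x; qr, a) − x/φ(qr))| ≤ C x ℒ^{−A}`
(`|∑ δ_r S_r| ≤ ∑ |S_r|`). [cite: BombieriFriedlanderIwaniecActa1986, §1 Theorems 8, 9 p. 209] -/
theorem BombieriFriedlanderIwaniecTheorem9.signed (h : BombieriFriedlanderIwaniecTheorem9)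
    {a : ℤ} (ha : a ≠ 0) {ε : ℝ} (hε : 0 < ε) {A : ℝ} (hA : 0 < A) :
    ∃ B C x₀ : ℝ, ∀ x : ℝ, x₀ ≤ x → ∀ Q R : ℝ,
      R < x ^ (1 / 10 - ε) → Q * R < x / Real.log x ^ B → ∀ δ : ℕ → ℝ, (∀ r, |δ r| ≤ 1) →
        |∑ r ∈ (Icc 1 ⌊R⌋₊).filter (fun r : ℕ => IsCoprime (r : ℤ) a),
            δ r * ∑ q ∈ (Icc 1 ⌊Q⌋₊).filter (fun q : ℕ => IsCoprime (q : ℤ) a),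
              (LevelOfDistribution.chebyshevPsiMod (q * r) (a : ZMod (q * r)) x -
                x / (Nat.totient (q * r) : ℝ))| ≤
          C * x / Real.log x ^ A := by
  obtain ⟨B, C, x₀, hB⟩ := h a ha ε hε A hA
  refine ⟨B, C, x₀, fun x hx Q R hR hQR δ hδ => ?_⟩
  refine (Finset.abs_sum_le_sum_abs _ _).trans (((Finset.sum_le_sum fun r _ => ?_)).trans
    (hB x hx Q R hR hQR))
  rw [abs_mul]
  exact (mul_le_mul_of_nonneg_right (hδ r) (abs_nonneg _)).trans (by rw [one_mul])

/-- Theorem 9 is equivalent to its signed form. [cite: BombieriFriedlanderIwaniecActa1986, §1 Theorems 8, 9 p. 209; §16 p. 250] -/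
theorem BombieriFriedlanderIwaniecTheorem9_iff_signed :
    BombieriFriedlanderIwaniecTheorem9 ↔
      ∀ a : ℤ, a ≠ 0 → ∀ ε : ℝ, 0 < ε → ∀ A : ℝ, 0 < A →
        ∃ B C x₀ : ℝ, ∀ x : ℝ, x₀ ≤ x → ∀ Q R : ℝ,
          R < x ^ (1 / 10 - ε) → Q * R < x / Real.log x ^ B → ∀ δ : ℕ → ℝ, (∀ r, |δ r| ≤ 1) →
            |∑ r ∈ (Icc 1 ⌊R⌋₊).filter (fun r : ℕ => IsCoprime (r : ℤ) a),
                δ r * ∑ q ∈ (Icc 1 ⌊Q⌋₊).filter (fun q : ℕ => IsCoprime (q : ℤ) a),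
                  (LevelOfDistribution.chebyshevPsiMod (q * r) (a : ZMod (q * r)) x -
                    x / (Nat.totient (q * r) : ℝ))| ≤
              C * x / Real.log x ^ A :=
  ⟨fun h _ ha _ hε _ hA => h.signed ha hε hA, BombieriFriedlanderIwaniecTheorem9.of_signed⟩


namespace BFI

/-! ### §16: the combinatorial case split and the exponent arithmetic -/

/-- **BFI §16, the case split for Theorem 9** (p. 250).  Let `f i ≥ 0` be the exponents of a
decomposition `M₁ ⋯ M_j N₁ ⋯ N_j = x`, summing to `1` ((15.6)), let `θ ≥ 0` (`R = x^θ`) and let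
`e > 0` be a slack with `7θ + 18e ≤ 1` and `4θ + 24e < 1` (both hold for `θ < 1/10`, `e ≤ 1/60`).
Then EITHER some partial sum lies in `[θ + 2e, (1−θ)/3 − 2e]` ("if (15.6) has a partial sum `λ`
with `θ₂ + ε < λ < (1−θ₂)/3 − ε` (16.1) then Theorem 6 is applicable"), OR ELSE ("suppose (15.6)
has no partial sum in (16.1). Notice that `2(θ₂+ε) < (1−θ₂)/3 − ε`, so the terms of (15.6) which
are `< (1−θ₂)/3 − ε` give in total, say `τ`, with `τ ≤ θ₂ + ε` (16.2) … Hence (15.6) can be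
partitioned as `ν₁ + … + ν_k + τ = 1` with `ν₁ ≥ … ≥ ν_k ≥ (1−θ₂)/3 − ε`, `θ₂ + ε ≥ τ`.  This
implies that `1 ≤ k ≤ 3`"): every term `≥ θ + 2e` is `> (1−θ)/3 − 2e`, the other terms total
`< θ + 2e`, and the number `k` of terms `≥ θ + 2e` satisfies `1 ≤ k ≤ 3`.  PROVED from
`BFI.exists_subsum_mem_Icc_or` (`a = θ + 2e`, `b = (1−θ)/3 − 2e`).
[cite: BombieriFriedlanderIwaniecActa1986, §16 (16.1)–(16.2) p. 250] -/
theorem section16_dichotomy {ι : Type*} [Fintype ι] [DecidableEq ι] (f : ι → ℝ)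
    (hf : ∀ i, 0 ≤ f i) (hsum : ∑ i, f i = 1) {θ e : ℝ} (hθ : 0 ≤ θ) (he : 0 < e)
    (h1 : 7 * θ + 18 * e ≤ 1) (h2 : 4 * θ + 24 * e < 1) :
    (∃ s : Finset ι, θ + 2 * e ≤ ∑ i ∈ s, f i ∧ ∑ i ∈ s, f i ≤ (1 - θ) / 3 - 2 * e) ∨
      ((∀ i, θ + 2 * e ≤ f i → (1 - θ) / 3 - 2 * e < f i) ∧
        (∑ i ∈ univ.filter (fun i => f i < θ + 2 * e), f i) < θ + 2 * e ∧
        1 ≤ (univ.filter (fun i => θ + 2 * e ≤ f i)).card ∧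
        (univ.filter (fun i => θ + 2 * e ≤ f i)).card ≤ 3) := by
  rcases exists_subsum_mem_Icc_or f (a := θ + 2 * e) (b := (1 - θ) / 3 - 2 * e) (by linarith)
      (by linarith) with h | ⟨hsmall, hbig⟩
  · exact Or.inl h
  refine Or.inr ⟨hbig, hsmall, ?_, ?_⟩
  · -- at least one large term: otherwise the small terms would total `1 ≥ θ + 2e`
    rw [Nat.one_le_iff_ne_zero, Ne, Finset.card_eq_zero, Finset.filter_eq_empty_iff]
    intro hnone
    have hall : univ.filter (fun i => f i < θ + 2 * e) = univ := by
      ext i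
      simp only [mem_filter, mem_univ, true_and, iff_true]
      exact not_le.mp (hnone (mem_univ i))
    rw [hall, hsum] at hsmall
    linarith
  · -- at most three large terms: each exceeds `(1−θ)/3 − 2e > 1/4`, and they total `≤ 1`
    by_contra h4
    push Not at h4
    set big := univ.filter (fun i => θ + 2 * e ≤ f i) with hbig_def
    have hle1 : ∑ i ∈ big, f i ≤ 1 := by
      rw [← hsum]
      exact Finset.sum_le_sum_of_subset_of_nonneg (Finset.filter_subset _ _) fun i _ _ => hf i
    have hlow : (big.card : ℝ) * ((1 - θ) / 3 - 2 * e) ≤ ∑ i ∈ big, f i := by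
      rw [← nsmul_eq_mul]
      exact Finset.card_nsmul_le_sum _ _ _ fun i hi => (hbig i (mem_filter.1 hi).2).le
    have hcard : (4 : ℝ) ≤ big.card := by exact_mod_cast h4
    have hbpos : 0 < (1 - θ) / 3 - 2 * e := by linarith
    nlinarith

/-- **(16.1) gives the range of Theorem 6**, as exponent arithmetic.  If the partial sum `λ`
(`N = x^λ`) satisfies `θ + 2e ≤ λ ≤ (1−θ)/3 − 2e` (`R = x^θ`), then for every block of moduli
`r ∼ R' = x^{θ'}` with `θ' ≤ θ` the range `x^e R' < N < x^{−e} (x/R')^{1/3}` of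
`Literature.NumberTheory.Sieve.BombieriFriedlanderIwaniecTheorem6` (with its `ε = e`) holds on the
logarithmic scale: `e + θ' < λ` and `λ < −e + (1 − θ')/3`.  PROVED (linear arithmetic).
[cite: BombieriFriedlanderIwaniecActa1986, §16 (16.1) p. 250; §13 Theorem 6 p. 244] -/
theorem range_theorem6_of_mem {θ θ' e lam : ℝ} (he : 0 < e) (hθ' : θ' ≤ θ)
    (h1 : θ + 2 * e ≤ lam) (h2 : lam ≤ (1 - θ) / 3 - 2 * e) :
    e + θ' < lam ∧ lam < -e + (1 - θ') / 3 :=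
  ⟨by linarith, by linarith⟩

/-- **(16.2) gives the ranges (14.5)–(14.6) of Theorem 7*, case `k ≥ 2`**, as exponent
arithmetic (p. 250: "We now apply Theorem 7* with `M = x^{ν₁}` and `N = x^{ν₂}` … so
`L = x/MN ≤ x^{1−2(1−θ₂)/3+2ε}`.  We verify the hypotheses (14.5) and (14.6) as follows:
`LR < x^{1−2(1−θ₂)/3+θ₂+3ε} < x^{1/2−ε}` and `L^{1/2}RM^{−1} < x^{1/2−(1−θ₂)/3+θ₂−(1−θ₂)/3+2ε} < x^{−ε}`;
since `θ₂ < 1/10`, the previous inequalities hold for sufficiently small `ε`").  With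
`θ < 1/10 − ε` (Theorem 9: `R < x^{1/10−ε}`), a slack `0 < e`, `5e ≤ ε`, two large exponents
`ν₁, ν₂ > (1−θ)/3 − 2e`, `L = x^ℓ` with `ℓ ≤ 1 − ν₁ − ν₂`, and any block `R' = x^{θ'}`,
`θ' ≤ θ`: (14.5) `ℓ + θ' < 1/2 − e` and (14.6) `ℓ/2 + θ' < ν₁ − e` (i.e. `L^{1/2} R' < M x^{−e}`).
PROVED (linear arithmetic). [cite: BombieriFriedlanderIwaniecActa1986, §16 p. 250; §14 (14.5)–(14.6) p. 246] -/
theorem range_theorem7Star_of_two_le {θ θ' e ε ν₁ ν₂ ℓ : ℝ} (hθ : θ < 1 / 10 - ε) (hθ' : θ' ≤ θ)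
    (he : 0 < e) (heε : 5 * e ≤ ε) (hν₁ : (1 - θ) / 3 - 2 * e < ν₁) (hν₂ : (1 - θ) / 3 - 2 * e < ν₂)
    (hℓ : ℓ ≤ 1 - ν₁ - ν₂) :
    ℓ + θ' < 1 / 2 - e ∧ ℓ / 2 + θ' < ν₁ - e :=
  ⟨by linarith, by linarith⟩

/-- **(16.2) gives the ranges (14.5)–(14.6) of Theorem 7*, case `k = 1`** (p. 250: `N = 1`,
`L = x/M = x^τ`): with `θ < 1/10 − ε`, `0 < e`, `5e ≤ ε`, the single large exponent
`ν₁ = 1 − τ > 1 − θ − 2e` and `L = x^ℓ`, `ℓ < θ + 2e` (the total `τ` of the small terms), and any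
block `R' = x^{θ'}`, `θ' ≤ θ`: (14.5) `ℓ + θ' < 1/2 − e` and (14.6) `ℓ/2 + θ' < ν₁ − e`.
PROVED (linear arithmetic). [cite: BombieriFriedlanderIwaniecActa1986, §16 p. 250; §14 (14.5)–(14.6) p. 246] -/
theorem range_theorem7Star_of_one {θ θ' e ε ν₁ ℓ : ℝ} (hθ : θ < 1 / 10 - ε) (hθ' : θ' ≤ θ)
    (he : 0 < e) (heε : 5 * e ≤ ε) (hν₁ : 1 - θ - 2 * e < ν₁) (hℓτ : ℓ < θ + 2 * e) :
    ℓ + θ' < 1 / 2 - e ∧ ℓ / 2 + θ' < ν₁ - e :=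
  ⟨by linarith, by linarith⟩

/-- The thresholds of `section16_dichotomy` are admissible in the setting of Theorem 9: for
`θ < 1/10` and `0 < e ≤ 1/60` one has `7θ + 18e ≤ 1` and `4θ + 24e < 1`. [folklore] -/
theorem section16_thresholds {θ e : ℝ} (hθ : θ < 1 / 10) (he : 0 < e) (he' : e ≤ 1 / 60) :
    7 * θ + 18 * e ≤ 1 ∧ 4 * θ + 24 * e < 1 :=
  ⟨by linarith, by linarith⟩

end BFI

end Literature.NumberTheory.Sieve
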